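import Summits.MatrixMultiplication.OmegaCensus.DihedralClassification

/-!
# ω-census, family (b3): conjecture C9 on the dicyclic family — `QuaternionGroup n` is box-useful iff `n ∈ {1, 2, 3}`

HONEST FRAMING (pub-omega census; verbatim): lottery ticket; floor = certified bounds/negative ranges.
Census BOOKKEEPING (conjecture C9 of the cell; pub-omega stpp-1 gen 18): the dicyclic groups `Dic_n = QuaternionGroup n`
(order `4n`; `Q₈ = n = 2`, generalized quaternion for `n` a power of `2`) map ONTO the dihedral groups:
`quaternionToDihedral n : QuaternionGroup n →* DihedralGroup n`, `a_i ↦ r_i`, `xa_i ↦ sr_i` through the reduction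
`ℤ/2n → ℤ/n` (the relation `xa_i xa_j = a_{n+j−i}` maps to `sr_i sr_j = r_{j−i}` because `n ↦ 0`); it is surjective.  So
box-uselessness of `D_{2n}` (`DihedralClassification.not_boxUseful_dihedral`, every `n ≥ 5`, `n ≠ 6`) lifts
(`not_boxUseful_of_surjective'`), and with the kernel rows `Q₁₆` (`n = 4`, `BoxBadSmallGroups`) and `Dic₆` (`n = 6`,
`BoxBadSmallGroups2`): **`QuaternionGroup n` is NOT box-useful for every `n ≥ 4`**; while `QuaternionGroup 1 ≅ C₄` (abelian),
`Q₈` (centre of index `4`) and `Dic₃` (centre of index `6`) ARE box-useful.  Hence the CLASSIFICATION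
`boxUseful_quaternion_iff : BoxUseful (QuaternionGroup n) ↔ n ∈ {1, 2, 3}` (`n ≥ 1`) — conjecture C9 (b) holds on the whole
dicyclic family as well.  Nothing here is progress on `ω`.
-/

namespace Summit.MatrixMultiplication.OmegaCensus

open Finset ProductBoxBound

/-- The reduction `ℤ/2n → ℤ/n`. [folklore] -/
def zmodHalf (n : ℕ) : ZMod (2 * n) →+* ZMod n := ZMod.castHom (dvd_mul_left n 2) (ZMod n)

/-- **The projection `Dic_n ↠ D_{2n}`**: `a_i ↦ r_i`, `xa_i ↦ sr_i` (exponents reduced mod `n`). [folklore] -/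
def quaternionToDihedral (n : ℕ) : QuaternionGroup n →* DihedralGroup n where
  toFun g := match g with
    | QuaternionGroup.a i => DihedralGroup.r (zmodHalf n i)
    | QuaternionGroup.xa i => DihedralGroup.sr (zmodHalf n i)
  map_one' := by
    show DihedralGroup.r (zmodHalf n 0) = 1
    rw [map_zero, DihedralGroup.one_def]
  map_mul' x y := by
    rcases x with i | i <;> rcases y with j | j
    · show DihedralGroup.r (zmodHalf n (i + j)) = DihedralGroup.r (zmodHalf n i) * DihedralGroup.r (zmodHalf n j)
      rw [map_add, DihedralGroup.r_mul_r]
    · show DihedralGroup.sr (zmodHalf n (j - i)) = DihedralGroup.r (zmodHalf n i) * DihedralGroup.sr (zmodHalf n j)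
      rw [map_sub, DihedralGroup.r_mul_sr]
    · show DihedralGroup.sr (zmodHalf n (i + j)) = DihedralGroup.sr (zmodHalf n i) * DihedralGroup.r (zmodHalf n j)
      rw [map_add, DihedralGroup.sr_mul_r]
    · show DihedralGroup.r (zmodHalf n ((n : ZMod (2 * n)) + j - i)) =
        DihedralGroup.sr (zmodHalf n i) * DihedralGroup.sr (zmodHalf n j)
      rw [map_sub, map_add, map_natCast, ZMod.natCast_self, zero_add, DihedralGroup.sr_mul_sr]

/-- The projection is surjective. [folklore] -/
theorem quaternionToDihedral_surjective (n : ℕ) : Function.Surjective (quaternionToDihedral n) := by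
  intro g
  rcases g with k | k
  · obtain ⟨i, hi⟩ := ZMod.castHom_surjective (dvd_mul_left n 2) k
    exact ⟨QuaternionGroup.a i, by show DihedralGroup.r (zmodHalf n i) = _; rw [zmodHalf, hi]⟩
  · obtain ⟨i, hi⟩ := ZMod.castHom_surjective (dvd_mul_left n 2) k
    exact ⟨QuaternionGroup.xa i, by show DihedralGroup.sr (zmodHalf n i) = _; rw [zmodHalf, hi]⟩

/-- **`QuaternionGroup n` (order `4n`) is not box-useful for every `n ≥ 4`.** [folklore] -/
theorem not_boxUseful_quaternion {n : ℕ} [NeZero n] (h4 : 4 ≤ n) : ¬ BoxUseful (QuaternionGroup n) := by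
  rcases (show n = 4 ∨ n = 6 ∨ (5 ≤ n ∧ n ≠ 6) by omega) with rfl | rfl | ⟨h5, h6⟩
  · exact not_boxUseful_quaternion4
  · exact not_boxUseful_quaternion6
  · exact not_boxUseful_of_surjective' (quaternionToDihedral n) (quaternionToDihedral_surjective n)
      (not_boxUseful_dihedral h5 h6)

/-- `QuaternionGroup 1 ≅ C₄` is box-useful (abelian). [folklore] -/
theorem boxUseful_quaternion_one : BoxUseful (QuaternionGroup 1) :=
  BoxUseful.of_index_center_one (center_index_one_of_comm (by decide))

/-- `Q₈ = QuaternionGroup 2` is box-useful (centre `{±1}` of index `4`). [folklore] -/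
theorem boxUseful_quaternion_two : BoxUseful (QuaternionGroup 2) := by
  apply BoxUseful.of_index_center_four
  apply center_index_of_card (c := 2) _ (by rw [Nat.card_eq_fintype_card, QuaternionGroup.card]) (by norm_num)
  rw [Nat.card_eq_fintype_card]; decide

/-- `Dic₃ = QuaternionGroup 3` is box-useful (centre of index `6`). [folklore] -/
theorem boxUseful_quaternion_three : BoxUseful (QuaternionGroup 3) := by
  apply BoxUseful.of_index_center_six
  apply center_index_of_card (c := 2) _ (by rw [Nat.card_eq_fintype_card, QuaternionGroup.card]) (by norm_num)
  rw [Nat.card_eq_fintype_card]; decide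

/-- **CLASSIFICATION of the dicyclic family under C9: `QuaternionGroup n` (`n ≥ 1`) is box-useful iff `n ∈ {1, 2, 3}`** —
the abelian `C₄`, the centre-index-`4` group `Q₈` and the centre-index-`6` group `Dic₃`, as conjecture C9 (b) predicts. [folklore] -/
theorem boxUseful_quaternion_iff {n : ℕ} [NeZero n] : BoxUseful (QuaternionGroup n) ↔ n = 1 ∨ n = 2 ∨ n = 3 := by
  constructor
  · intro h
    by_contra hne
    push Not at hne
    obtain ⟨h1, h2, h3⟩ := hne
    have hn0 : n ≠ 0 := NeZero.ne n
    exact not_boxUseful_quaternion (by omega) h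
  · rintro (rfl | rfl | rfl)
    · exact boxUseful_quaternion_one
    · exact boxUseful_quaternion_two
    · exact boxUseful_quaternion_three

end Summit.MatrixMultiplication.OmegaCensus
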